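import Mathlib.Analysis.SpecialFunctions.Complex.Arg
import Mathlib.Analysis.SpecialFunctions.Complex.Log
import Literature.MathematicalPhysics.QuantumLattice.LiebFluxPhaseCount
import Literature.MathematicalPhysics.QuantumLattice.FinDimSpectrumProofs
import Literature.MathematicalPhysics.QuantumLattice.HubbardModelParticleHoleProofs
import HarnessLib

/-!
# Proof of Lieb's flux-phase theorem on the even square torus (`Lieb1994_fluxPi_torus_holds`)

E. H. Lieb, *Flux phase of the half-filled band*, PRL **73** (1994) 2158, Theorem ("Flux `π` is
optimal"), for the square torus `(ℤ/Lℤ)²`, `L` even, `L ≥ 4`, uniform `|t|`, constant `U`: the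
discharge of the named fact `Lieb1994_fluxPi_torus` of `LiebFluxPhase.lean`.

## The argument (Lieb, pp. 3–4, "repeated reflection … in the standard way", p. 2)

Phase configurations are unit complex amplitudes `u σ x y` with `u σ y x = (u σ x y)^*`
(`IsCfg`), a compact set (`isCompact_cfgSet`) on which `Z_β(u) = Re Tr e^{-βH(tu)}` is continuous,
so a maximiser exists. Among the maximisers take one with the largest number of `π`-plaquettes
(`piCount`). If one of its plaquettes is not `π`: translate it to a cut column (translations are
graph automorphisms, `Z`, `piCount` invariant), gauge the cut bonds to `1` (`orbitalPhase`, Lieb's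
"`t_{lr} = |t_{lr}|`", everything invariant), and apply the reflection-positivity inequality
`Z(u)² ≤ Z(u^{LL}) Z(u^{RR})` (`LiebFluxPhaseRP.partitionFn_sq_le_reflected`): both reflected
configurations are again maximisers, and by `LiebFluxPhaseCount.piCount_symm_add` one of them has
more `π`-plaquettes — a contradiction. Hence a maximiser with flux `π` in EVERY plaquette exists
(`exists_isMaxOn_piFlux`); lifting `u` to antisymmetric phases `θ` (`liftPhase`, `Complex.arg`)
gives part (1). Part (2) (`β = ∞`): `e^{-βE₀} ≤ Z_β ≤ D e^{-βE₀}` turns part (1) at `β = n` into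
`E₀(u_n) ≤ E₀(u) + (log D)/n` for `π`-flux `u_n`; the ground energy is continuous on the compact
`π`-flux class (variational principle, `minEnergyOn_top_holds`), so its minimiser there does at
least as well as every `u`.

## References

* [Lieb1994] E. H. Lieb, Phys. Rev. Lett. 73 (1994) 2158, Lemma, Theorem and Remark (iii), pp. 2–4.
-/

noncomputable section

namespace Literature.MathematicalPhysics.QuantumLattice

open Matrix Finset HubbardWave0 FermionTorus Filter Topology Literature.Probability.LatticeModels
open scoped ComplexOrder

/-! ### Ground energy: variational continuity and comparison with the partition function -/

section Spectral

variable {m : Type*} [Fintype m] [DecidableEq m]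

omit [DecidableEq m] in
/-- A crude bound for expectation values in unit vectors: `Re ⟨ψ, A ψ⟩ ≥ -Σ_{s,t} ‖A_{st}‖`
(cf. `neg_sum_norm_le_re_expect`). [folklore] -/
theorem neg_sum_norm_le_re_rayleigh (A : Matrix m m ℂ) {ψ : m → ℂ} (hψ : star ψ ⬝ᵥ ψ = 1) :
    -(∑ s, ∑ t, ‖A s t‖) ≤ (star ψ ⬝ᵥ A *ᵥ ψ).re := by
  have h1 : ‖star ψ ⬝ᵥ A *ᵥ ψ‖ ≤ ∑ s, ∑ t, ‖A s t‖ := by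
    simp only [dotProduct, mulVec]
    calc ‖∑ s, (star ψ) s * ∑ t, A s t * ψ t‖
        ≤ ∑ s, ‖(star ψ) s * ∑ t, A s t * ψ t‖ := norm_sum_le _ _
      _ ≤ ∑ s, ∑ t, ‖A s t‖ := Finset.sum_le_sum fun s _ => by
          rw [norm_mul, Pi.star_apply, norm_star]
          calc ‖ψ s‖ * ‖∑ t, A s t * ψ t‖ ≤ 1 * ∑ t, ‖A s t‖ := by
                apply mul_le_mul (norm_apply_le_one_of_dotProduct_eq_one hψ s) _ (norm_nonneg _)
                  zero_le_one
                calc ‖∑ t, A s t * ψ t‖ ≤ ∑ t, ‖A s t * ψ t‖ := norm_sum_le _ _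
                  _ ≤ ∑ t, ‖A s t‖ := Finset.sum_le_sum fun t _ => by
                      rw [norm_mul]
                      calc ‖A s t‖ * ‖ψ t‖ ≤ ‖A s t‖ * 1 :=
                            mul_le_mul_of_nonneg_left (norm_apply_le_one_of_dotProduct_eq_one hψ t)
                              (norm_nonneg _)
                        _ = ‖A s t‖ := mul_one _
            _ = ∑ t, ‖A s t‖ := one_mul _
  have h2 := Complex.abs_re_le_norm (star ψ ⬝ᵥ A *ᵥ ψ)
  exact neg_le_of_abs_le (h2.trans h1)

variable [Nonempty m]

/-- **Variational stability of the ground energy**: for Hermitian `A, B`,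
`E₀(B) - Σ_{s,t} ‖A_{st} - B_{st}‖ ≤ E₀(A)` (`E₀(A) = inf_ψ Re⟨ψ,Aψ⟩` and `|⟨ψ,(A-B)ψ⟩| ≤ Σ‖A-B‖`).
[folklore] -/
theorem groundEnergy_sub_sum_norm_le {A B : Matrix m m ℂ} (hA : A.IsHermitian) (hB : B.IsHermitian) :
    B.groundEnergy - ∑ s, ∑ t, ‖A s t - B s t‖ ≤ A.groundEnergy := by
  rw [← minEnergyOn_top_holds hA, Matrix.minEnergyOn]
  obtain ⟨i₀⟩ := ‹Nonempty m›
  apply le_csInf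
  · refine ⟨(star (Pi.single i₀ (1 : ℂ)) ⬝ᵥ A *ᵥ Pi.single i₀ 1).re, Pi.single i₀ 1, Submodule.mem_top, ?_, rfl⟩
    simp
  · rintro E ⟨ψ, -, hψ, rfl⟩
    have h1 := groundEnergy_le_rayleigh_holds hB ψ hψ
    have h2 : -(∑ s, ∑ t, ‖A s t - B s t‖) ≤ (star ψ ⬝ᵥ (A - B) *ᵥ ψ).re := by
      simpa only [Matrix.sub_apply] using neg_sum_norm_le_re_rayleigh (A - B) hψ
    have h3 : star ψ ⬝ᵥ A *ᵥ ψ = star ψ ⬝ᵥ B *ᵥ ψ + star ψ ⬝ᵥ (A - B) *ᵥ ψ := by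
      rw [sub_mulVec, dotProduct_sub]; ring
    rw [h3, Complex.add_re]
    linarith

/-- Two-sided form: `|E₀(A) - E₀(B)| ≤ Σ_{s,t} ‖A_{st} - B_{st}‖`. [folklore] -/
theorem abs_groundEnergy_sub_le {A B : Matrix m m ℂ} (hA : A.IsHermitian) (hB : B.IsHermitian) :
    |A.groundEnergy - B.groundEnergy| ≤ ∑ s, ∑ t, ‖A s t - B s t‖ := by
  have h1 := groundEnergy_sub_sum_norm_le hA hB
  have h2 := groundEnergy_sub_sum_norm_le hB hA
  have h3 : ∑ s, ∑ t, ‖B s t - A s t‖ = ∑ s, ∑ t, ‖A s t - B s t‖ :=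
    Finset.sum_congr rfl fun s _ => Finset.sum_congr rfl fun t _ => norm_sub_rev _ _
  rw [h3] at h2
  rw [abs_le]
  constructor <;> linarith

/-- **`e^{-βE₀} ≤ Re Z_β`** (keep the ground-state term of `Z = Σ e^{-βλᵢ}`). [folklore] -/
theorem exp_neg_mul_groundEnergy_le_partitionFn {H : Matrix m m ℂ} (hH : H.IsHermitian) (β : ℝ) :
    Real.exp (-(β * H.groundEnergy)) ≤ (H.partitionFn β).re := by
  rw [hH.partitionFn_eq_ofReal, Complex.ofReal_re, groundEnergy_eq_iInf_eigenvalues_holds hH]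
  obtain ⟨i₀, hi₀⟩ := exists_eq_ciInf_of_finite (f := hH.eigenvalues)
  rw [← hi₀]
  exact Finset.single_le_sum (f := fun i => Real.exp (-(β * hH.eigenvalues i))) (fun i _ => (Real.exp_pos _).le)
    (Finset.mem_univ i₀)

omit [Nonempty m] in
/-- **`Re Z_β ≤ D e^{-βE₀}`** for `β ≥ 0`, `D` the dimension. [folklore] -/
theorem partitionFn_le_card_mul_exp {H : Matrix m m ℂ} (hH : H.IsHermitian) {β : ℝ} (hβ : 0 ≤ β) :
    (H.partitionFn β).re ≤ Fintype.card m * Real.exp (-(β * H.groundEnergy)) := by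
  rw [hH.partitionFn_eq_ofReal, Complex.ofReal_re]
  calc ∑ i, Real.exp (-(β * hH.eigenvalues i)) ≤ ∑ _i : m, Real.exp (-(β * H.groundEnergy)) := by
        refine Finset.sum_le_sum fun i _ => Real.exp_le_exp.2 ?_
        have := groundEnergy_le_eigenvalues hH i
        nlinarith
    _ = Fintype.card m * Real.exp (-(β * H.groundEnergy)) := by
        rw [Finset.sum_const, Finset.card_univ, nsmul_eq_mul]

/-- **From partition functions to ground energies**: `Z_β(A) ≤ Z_β(B)` with `β > 0` gives
`E₀(B) ≤ E₀(A) + (log D)/β` — the `β → ∞` step of [Lieb1994, Remark (iii)]. [cite: Lieb1994, p. 2 and Remark (iii)] -/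
theorem groundEnergy_le_of_partitionFn_le {A B : Matrix m m ℂ} (hA : A.IsHermitian) (hB : B.IsHermitian)
    {β : ℝ} (hβ : 0 < β) (hZ : (A.partitionFn β).re ≤ (B.partitionFn β).re) :
    B.groundEnergy ≤ A.groundEnergy + Real.log (Fintype.card m) / β := by
  have hD : (0 : ℝ) < Fintype.card m := by exact_mod_cast Fintype.card_pos
  have h1 := exp_neg_mul_groundEnergy_le_partitionFn hA β
  have h2 := partitionFn_le_card_mul_exp hB hβ.le
  have h3 : Real.exp (-(β * A.groundEnergy)) ≤ Fintype.card m * Real.exp (-(β * B.groundEnergy)) :=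
    h1.trans (hZ.trans h2)
  have h4 := Real.log_le_log (Real.exp_pos _) h3
  rw [Real.log_mul hD.ne' (Real.exp_pos _).ne', Real.log_exp, Real.log_exp] at h4
  have key : B.groundEnergy - A.groundEnergy ≤ Real.log (Fintype.card m) / β := by
    rw [le_div_iff₀ hβ]; linarith
  linarith

end Spectral

/-! ### Phase configurations on the torus -/

namespace LiebRP

attribute [local instance] decEqTorus

variable {L : ℕ} [NeZero L]

/-- **Phase configurations**: unit complex amplitudes, Hermitian under bond reversal
(`t_{xy} = |t| e^{iφ(x,y)}`, `φ(x,y) = -φ(y,x)`). [cite: Lieb1994, p. 1] -/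
def IsCfg (u : Cfg L) : Prop := ∀ σ x y, ‖u σ x y‖ = 1 ∧ u σ y x = star (u σ x y)

/-- The set of phase configurations. [cite: Lieb1994, p. 1] -/
def cfgSet (L : ℕ) : Set (Cfg L) := {u | IsCfg u}

/-- The hopping amplitudes `t · u`. [cite: Lieb1994, p. 1] -/
def Tamp (t : ℝ) (u : Cfg L) : Cfg L := fun σ x y => (t : ℂ) * u σ x y

/-- The Hamiltonian of a configuration. [cite: Lieb1994, eqs. (1)–(2)] -/
abbrev Ham (t U : ℝ) (u : Cfg L) : Matrix (Finset (Orb (FermionTorus 2 L))) (Finset (Orb (FermionTorus 2 L))) ℂ :=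
  peierlsHubbard (G L) (Tamp t u) U

/-- `Re Z_β` of a configuration. [cite: Lieb1994, p. 2 (`Z = Tr exp[-βH]`)] -/
def Zre (β t U : ℝ) (u : Cfg L) : ℝ := ((Ham t U u).partitionFn β).re

omit [NeZero L] in
/-- The amplitudes of a configuration are Hermitian. [folklore] -/
theorem Tamp_herm {u : Cfg L} (hu : IsCfg u) (t : ℝ) (σ : Fin 2) (x y : FermionTorus 2 L) :
    Tamp t u σ y x = star (Tamp t u σ x y) := by
  show (t : ℂ) * u σ y x = star ((t : ℂ) * u σ x y)
  rw [(hu σ x y).2, star_mul', Complex.star_def, Complex.conj_ofReal]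

omit [NeZero L] in
/-- The Hamiltonian of a configuration is Hermitian. [folklore] -/
theorem Ham_isHermitian {u : Cfg L} (hu : IsCfg u) (t U : ℝ) : (Ham t U u).IsHermitian :=
  peierlsHubbard_isHermitian _ _ (Tamp_herm hu t) U

omit [NeZero L] in
/-- `Z_β(u) > 0`. [folklore] -/
theorem Zre_pos {u : Cfg L} (hu : IsCfg u) (β t U : ℝ) : 0 < Zre β t U u :=
  partitionFn_peierlsHubbard_re_pos _ _ (Tamp_herm hu t) U β

/-! ### Compactness and continuity -/

omit [NeZero L] in
/-- The configuration set is compact (closed and bounded in the finite product of `ℂ`'s).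
[folklore] -/
theorem isCompact_cfgSet : IsCompact (cfgSet L) := by
  apply Metric.isCompact_of_isClosed_isBounded
  · have h : cfgSet L = ⋂ σ : Fin 2, ⋂ x : FermionTorus 2 L, ⋂ y : FermionTorus 2 L,
        {u : Cfg L | ‖u σ x y‖ = 1} ∩ {u : Cfg L | u σ y x = star (u σ x y)} := by
      ext u
      simp only [cfgSet, IsCfg, Set.mem_setOf_eq, Set.mem_iInter, Set.mem_inter_iff]
    rw [h]
    refine isClosed_iInter fun σ => isClosed_iInter fun x => isClosed_iInter fun y => IsClosed.inter ?_ ?_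
    · have hc : Continuous fun u : Cfg L => ‖u σ x y‖ := by fun_prop
      exact isClosed_eq hc continuous_const
    · have hc1 : Continuous fun u : Cfg L => u σ y x := by fun_prop
      have hc2 : Continuous fun u : Cfg L => star (u σ x y) := by fun_prop
      exact isClosed_eq hc1 hc2
  · refine (Metric.isBounded_closedBall (x := (0 : Cfg L)) (r := 1)).subset fun u hu => ?_
    rw [Metric.mem_closedBall, dist_zero_right, pi_norm_le_iff_of_nonneg zero_le_one]
    intro σ
    rw [pi_norm_le_iff_of_nonneg zero_le_one]
    intro x
    rw [pi_norm_le_iff_of_nonneg zero_le_one]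
    intro y
    exact (hu σ x y).1.le

omit [NeZero L] in
/-- The constant configuration `u ≡ 1`. [folklore] -/
theorem one_mem_cfgSet : (fun _ _ _ => (1 : ℂ)) ∈ cfgSet L := fun σ x y => ⟨by simp, by simp⟩

/-- The Peierls–Hubbard Hamiltonian depends continuously on the amplitudes. [folklore] -/
theorem continuous_peierlsHubbard {Λ : Type*} [LinearOrder Λ] [Fintype Λ] (G : SimpleGraph Λ)
    [DecidableRel G.Adj] (U : ℝ) : Continuous fun T : Fin 2 → Λ → Λ → ℂ => peierlsHubbard G T U := by
  simp only [peierlsHubbard_def]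
  refine Continuous.add (Continuous.neg (continuous_finsetSum _ fun x _ => continuous_finsetSum _ fun y _ =>
    continuous_finsetSum _ fun σ _ => ?_)) continuous_const
  by_cases h : G.Adj x y
  · simp only [if_pos h]
    have hc : Continuous fun T : Fin 2 → Λ → Λ → ℂ => T σ x y := by fun_prop
    exact hc.smul continuous_const
  · simp only [if_neg h]
    exact continuous_const

omit [NeZero L] in
/-- `u ↦ t · u` is continuous. [folklore] -/
theorem continuous_Tamp (t : ℝ) : Continuous (Tamp (L := L) t) := by
  unfold Tamp
  fun_prop

/-- The partition function depends continuously on the Hamiltonian. [folklore] -/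
theorem continuous_partitionFn_re {m : Type*} [Fintype m] [DecidableEq m] (β : ℝ) :
    Continuous fun H : Matrix m m ℂ => (H.partitionFn β).re := by
  letI : NormedRing (Matrix m m ℂ) := Matrix.linftyOpNormedRing
  letI : NormedAlgebra ℂ (Matrix m m ℂ) := Matrix.linftyOpNormedAlgebra
  letI : NormedAlgebra ℚ (Matrix m m ℂ) := .restrictScalars ℚ ℂ _
  have h1 : Continuous fun H : Matrix m m ℂ => NormedSpace.exp (-(β : ℂ) • H) :=
    NormedSpace.exp_continuous.comp (continuous_id.const_smul (-(β : ℂ)))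
  exact Complex.continuous_re.comp h1.matrix_trace

omit [NeZero L] in
/-- `u ↦ Z_β(u)` is continuous. [folklore] -/
theorem continuous_Zre (β t U : ℝ) : Continuous (Zre (L := L) β t U) :=
  (continuous_partitionFn_re β).comp ((continuous_peierlsHubbard _ U).comp (continuous_Tamp t))

omit [NeZero L] in
/-- `u ↦ E₀(H(u))` is continuous on the configurations (variational stability). [folklore] -/
theorem continuousOn_groundEnergy (t U : ℝ) :
    ContinuousOn (fun u : Cfg L => (Ham t U u).groundEnergy) (cfgSet L) := by
  intro u₀ hu₀
  rw [ContinuousWithinAt, Metric.tendsto_nhds]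
  intro ε hε
  have hH : Continuous fun u : Cfg L => Ham t U u := (continuous_peierlsHubbard _ U).comp (continuous_Tamp t)
  have hc : Continuous fun u : Cfg L => ∑ s, ∑ t', ‖Ham t U u s t' - Ham t U u₀ s t'‖ := by
    refine continuous_finsetSum _ fun s _ => continuous_finsetSum _ fun t' _ => continuous_norm.comp ?_
    refine Continuous.sub ?_ continuous_const
    exact (continuous_apply_apply s t').comp hH
  have h0 : (∑ s, ∑ t', ‖Ham t U u₀ s t' - Ham t U u₀ s t'‖) = 0 := by simp
  have hlt : ∀ᶠ u in 𝓝[cfgSet L] u₀, (∑ s, ∑ t', ‖Ham t U u s t' - Ham t U u₀ s t'‖) < ε := by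
    have := (hc.tendsto u₀).eventually (gt_mem_nhds (show (∑ s, ∑ t', ‖Ham t U u₀ s t' - Ham t U u₀ s t'‖) < ε by
      rw [h0]; exact hε))
    exact this.filter_mono nhdsWithin_le_nhds
  have hmem : ∀ᶠ u in 𝓝[cfgSet L] u₀, u ∈ cfgSet L := eventually_mem_nhdsWithin
  filter_upwards [hlt, hmem] with u hu hum
  rw [Real.dist_eq]
  exact (abs_groundEnergy_sub_le (Ham_isHermitian hum t U) (Ham_isHermitian hu₀ t U)).trans_lt hu

/-! ### Translations -/

/-- The horizontal translation by `d` columns. [folklore] -/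
def transl (d : ℕ) : FermionTorus 2 L ≃ FermionTorus 2 L :=
  FermionTorus.ofTorusEquiv (Equiv.addRight (Pi.single 0 (d : ZMod L)))

/-- The translate of a configuration: `u'(x, y) = u(x - d e₀, y - d e₀)`. [folklore] -/
def translate (d : ℕ) (u : Cfg L) : Cfg L := fun σ x y => u σ ((transl d).symm x) ((transl d).symm y)

/-- Translations commute with the shifts. [folklore] -/
theorem transl_shift (d : ℕ) (x : FermionTorus 2 L) (μ : Fin 2) : transl d (shift x μ) = shift (transl d x) μ := by
  apply toTorusSite_injective
  simp only [transl, toTorusSite_ofTorusEquiv, toTorusSite_shift, Equiv.coe_addRight]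
  abel

/-- Inverse translations commute with the shifts. [folklore] -/
theorem transl_symm_shift (d : ℕ) (x : FermionTorus 2 L) (μ : Fin 2) :
    (transl d).symm (shift x μ) = shift ((transl d).symm x) μ := by
  apply (transl d).injective
  rw [Equiv.apply_symm_apply, transl_shift, Equiv.apply_symm_apply]

/-- Plaquette products are transported: `plaq (translate u) (τ x) = plaq u x`. [folklore] -/
theorem plaq_translate (d : ℕ) (u : Cfg L) (σ : Fin 2) (x : FermionTorus 2 L) :
    plaq (translate d u) σ (transl d x) = plaq u σ x := by
  simp only [plaq, translate, ← transl_shift, Equiv.symm_apply_apply]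

/-- `piCount` is translation invariant. [folklore] -/
theorem piCount_translate (d : ℕ) (u : Cfg L) : piCount (translate d u) = piCount u := by
  unfold piCount
  refine Finset.card_bij' (fun p _ => (p.1, (transl d).symm p.2)) (fun q _ => (q.1, transl d q.2)) ?_ ?_ ?_ ?_
  · rintro ⟨σ, x⟩ hp
    simp only [Finset.mem_filter, Finset.mem_univ, true_and] at hp ⊢
    rw [← plaq_translate d u σ, Equiv.apply_symm_apply]
    exact hp
  · rintro ⟨σ, y⟩ hq
    simp only [Finset.mem_filter, Finset.mem_univ, true_and] at hq ⊢
    rw [plaq_translate]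
    exact hq
  · rintro ⟨σ, x⟩ _; simp
  · rintro ⟨σ, y⟩ _; simp

/-- Translates of configurations are configurations. [folklore] -/
theorem isCfg_translate (d : ℕ) {u : Cfg L} (hu : IsCfg u) : IsCfg (translate d u) :=
  fun σ _ _ => hu σ _ _

/-- **Translation invariance of `Z`** (translations are automorphisms of the torus graph;
`relabel` covariance). [folklore] -/
theorem Zre_translate (d : ℕ) (u : Cfg L) (β t U : ℝ) : Zre β t U (translate d u) = Zre β t U u := by
  unfold Zre Ham
  have h := partitionFn_peierlsHubbard_relabel (G L) (G L) (transl (L := L) d)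
    (fun x y => fermionTorusGraph_adj_addRight _ x y) (Tamp t u) U β
  rw [← h]
  rfl

/-- The column of a translate: `col (τ_d x) = (col x + d) mod L`. [folklore] -/
theorem col_transl (d : ℕ) (x : FermionTorus 2 L) : col (transl d x) = (col x + d) % L := by
  have h : toTorusSite (transl d x) 0 = toTorusSite x 0 + (d : ZMod L) := by
    simp only [transl, toTorusSite_ofTorusEquiv, Equiv.coe_addRight, Pi.add_apply, Pi.single_eq_same]
  rw [toTorusSite_apply, toTorusSite_apply, ← Nat.cast_add] at h
  have h2 := congrArg ZMod.val h
  rw [ZMod.val_natCast, ZMod.val_natCast, Nat.mod_eq_of_lt (ofLex (transl d x) 0).isLt] at h2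
  exact h2

/-- Every column can be translated onto the cut column `L/2 - 1`. [folklore] -/
theorem exists_transl_isCut (h2 : 2 ≤ L) (x : FermionTorus 2 L) : ∃ d : ℕ, IsCut L (transl d x) := by
  refine ⟨L + (L / 2 - 1) - col x, Or.inl ?_⟩
  rw [col_transl]
  have := col_lt x
  rw [show col x + (L + (L / 2 - 1) - col x) = (L / 2 - 1) + L by omega, Nat.add_mod_right,
    Nat.mod_eq_of_lt (show L / 2 - 1 < L by omega)]
  omega

/-! ### Gauge fixing of the cut bonds -/

/-- The gauge function fixing the bonds through the vertical cut: the right endpoint of each cut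
bond absorbs the phase of the bond ("`c_r → exp[-iΘ(l,r)] c_r`", [Lieb1994, p. 3]). [cite: Lieb1994, p. 3] -/
def cutGauge (u : Cfg L) (σ : Fin 2) (x : FermionTorus 2 L) : ℂ :=
  if col x = L / 2 then u σ (unshift x 0) x else if col x + 1 = L then u σ (shift x 0) x else 1

/-- The gauge-transformed configuration. [cite: Lieb1994, p. 3] -/
def gaugeFix (u : Cfg L) : Cfg L := fun σ x y => cutGauge u σ x * star (cutGauge u σ y) * u σ x y

/-- The gauge function is a phase. [folklore] -/
theorem norm_cutGauge {u : Cfg L} (hu : IsCfg u) (σ : Fin 2) (x : FermionTorus 2 L) : ‖cutGauge u σ x‖ = 1 := by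
  unfold cutGauge
  split_ifs
  · exact (hu σ _ _).1
  · exact (hu σ _ _).1
  · simp

/-- A phase times its conjugate. [folklore] -/
theorem mul_star_self_of_norm_eq_one {z : ℂ} (hz : ‖z‖ = 1) : z * star z = 1 := by
  rw [Complex.star_def, Complex.mul_conj, Complex.normSq_eq_norm_sq, hz]; norm_num

/-- The gauge-fixed configuration is a configuration. [folklore] -/
theorem isCfg_gaugeFix {u : Cfg L} (hu : IsCfg u) : IsCfg (gaugeFix u) := by
  intro σ x y
  constructor
  · show ‖cutGauge u σ x * star (cutGauge u σ y) * u σ x y‖ = 1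
    rw [norm_mul, norm_mul, norm_star, norm_cutGauge hu, norm_cutGauge hu, (hu σ x y).1]
    norm_num
  · simp only [gaugeFix, star_mul', star_star, (hu σ x y).2]
    ring

/-- Plaquette products are gauge invariant ("the spectrum … depends on the `φ`'s only through the
fluxes", [Lieb1994, p. 1]). [cite: Lieb1994, p. 1] -/
theorem plaq_gaugeFix {u : Cfg L} (hu : IsCfg u) (σ : Fin 2) (x : FermionTorus 2 L) :
    plaq (gaugeFix u) σ x = plaq u σ x := by
  have h := fun y => mul_star_self_of_norm_eq_one (norm_cutGauge hu σ y)
  have key : plaq (gaugeFix u) σ x =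
      (cutGauge u σ x * star (cutGauge u σ x)) * (cutGauge u σ (shift x 0) * star (cutGauge u σ (shift x 0))) *
        (cutGauge u σ (shift (shift x 0) 1) * star (cutGauge u σ (shift (shift x 0) 1))) *
        (cutGauge u σ (shift x 1) * star (cutGauge u σ (shift x 1))) * plaq u σ x := by
    simp only [plaq, gaugeFix]; ring
  rw [key, h, h, h, h]; ring

/-- `piCount` is gauge invariant. [folklore] -/
theorem piCount_gaugeFix {u : Cfg L} (hu : IsCfg u) : piCount (gaugeFix u) = piCount u := by
  unfold piCount
  congr 1
  refine Finset.filter_congr fun p _ => ?_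
  rw [plaq_gaugeFix hu]

/-- **`Z` is gauge invariant.** [cite: Lieb1994, p. 1] -/
theorem Zre_gaugeFix {u : Cfg L} (hu : IsCfg u) (β t U : ℝ) : Zre β t U (gaugeFix u) = Zre β t U u := by
  unfold Zre Ham
  have h := partitionFn_peierlsHubbard_gauge (G L) (cutGauge u) (norm_cutGauge hu) (Tamp t u) U β
  have hT : Tamp t (gaugeFix u) = fun σ x y => cutGauge u σ x * star (cutGauge u σ y) * Tamp t u σ x y := by
    funext σ x y
    simp only [Tamp, gaugeFix]
    ring
  rw [← h, hT]

/-- **After the gauge fixing the cut bonds carry amplitude `1`** (Lieb's convention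
`t_{lr} = |t_{lr}|`). [cite: Lieb1994, p. 3] -/
theorem gaugeFix_cut (hL : Even L) (h4 : 4 ≤ L) {u : Cfg L} (hu : IsCfg u) (σ : Fin 2) (x : FermionTorus 2 L)
    (hx : IsBoundary L x) : gaugeFix u σ x (reflect x) = 1 := by
  have h2 : 2 ≤ L := by omega
  have hcx := col_lt x
  rcases hx with hx | hx
  · -- `R x = x + e₀`, column `L/2`
    have hR := reflect_eq_shift_of_col hL hx
    have hc : col (shift x 0) = L / 2 := by rw [col_shift_zero_of_lt (by omega)]; omega
    have hgx : cutGauge u σ x = 1 := by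
      unfold cutGauge; rw [if_neg (by omega), if_neg (by omega)]
    have hgy : cutGauge u σ (shift x 0) = u σ x (shift x 0) := by
      unfold cutGauge; rw [if_pos hc, unshift_shift]
    show cutGauge u σ x * star (cutGauge u σ (reflect x)) * u σ x (reflect x) = 1
    rw [hR, hgx, hgy, one_mul, mul_comm]
    exact mul_star_self_of_norm_eq_one (hu σ _ _).1
  · -- `R x = x - e₀`, column `L - 1`
    have hR := reflect_eq_unshift_of_col_zero hx
    have hc : col (unshift x 0) + 1 = L := by
      rw [col_unshift_zero, hx, add_zero, Nat.mod_eq_of_lt (show 1 < L by omega),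
        Nat.mod_eq_of_lt (show L - 1 < L by omega)]
      omega
    have hgx : cutGauge u σ x = 1 := by
      unfold cutGauge; rw [if_neg (by omega), if_neg (by omega)]
    have hgy : cutGauge u σ (unshift x 0) = u σ x (unshift x 0) := by
      unfold cutGauge
      rw [if_neg (by omega), if_pos hc, shift_unshift]
    show cutGauge u σ x * star (cutGauge u σ (reflect x)) * u σ x (reflect x) = 1
    rw [hR, hgx, hgy, one_mul, mul_comm]
    exact mul_star_self_of_norm_eq_one (hu σ _ _).1

/-! ### The reflected configurations -/

omit [NeZero L] in
/-- `amplLL` commutes with `u ↦ t · u` (`t` real). [folklore] -/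
theorem amplLL_Tamp (t : ℝ) (u : Cfg L) : amplLL (Tamp t u) = Tamp t (amplLL u) := by
  funext σ x y
  simp only [amplLL_apply, Tamp]
  split_ifs
  · rw [star_mul', Complex.star_def, Complex.conj_ofReal, mul_neg]
  · rfl

omit [NeZero L] in
/-- `amplRR` commutes with `u ↦ t · u` (`t` real). [folklore] -/
theorem amplRR_Tamp (t : ℝ) (u : Cfg L) : amplRR (Tamp t u) = Tamp t (amplRR u) := by
  funext σ x y
  simp only [amplRR_apply, Tamp]
  split_ifs
  · rw [star_mul', Complex.star_def, Complex.conj_ofReal, mul_neg]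
  · rfl

omit [NeZero L] in
/-- `amplLL` of a configuration is a configuration. [folklore] -/
theorem isCfg_amplLL {u : Cfg L} (hu : IsCfg u) : IsCfg (amplLL u) := by
  intro σ x y
  refine ⟨?_, amplLL_herm (fun σ x y => (hu σ x y).2) σ x y⟩
  rw [amplLL_apply]
  split_ifs
  · rw [norm_neg, norm_star]; exact (hu σ _ _).1
  · exact (hu σ x y).1

omit [NeZero L] in
/-- `amplRR` of a configuration is a configuration. [folklore] -/
theorem isCfg_amplRR {u : Cfg L} (hu : IsCfg u) : IsCfg (amplRR u) := by
  intro σ x y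
  refine ⟨?_, amplRR_herm (fun σ x y => (hu σ x y).2) σ x y⟩
  rw [amplRR_apply]
  split_ifs
  · rw [norm_neg, norm_star]; exact (hu σ _ _).1
  · exact (hu σ x y).1

/-- **The reflection-positivity inequality for configurations**:
`Z(u)² ≤ Z(amplLL u) · Z(amplRR u)` in Lieb's gauge. [cite: Lieb1994, Lemma, eq. (6)] -/
theorem Zre_sq_le (hL : Even L) (h4 : 4 ≤ L) {β t : ℝ} (hβ : 0 ≤ β) (ht : 0 ≤ t) (U : ℝ) {u : Cfg L}
    (hu : IsCfg u) (hcut : ∀ σ x, IsBoundary L x → u σ x (reflect x) = 1) :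
    Zre β t U u ^ 2 ≤ Zre β t U (amplLL u) * Zre β t U (amplRR u) := by
  have h := partitionFn_sq_le_reflected hL h4 hβ ht U (Tamp t u) (Tamp_herm hu t)
    (fun σ x hx => by simp only [Tamp, hcut σ x hx, mul_one])
  rw [amplLL_Tamp, amplRR_Tamp] at h
  exact h

/-! ### The extremal argument -/

/-- **A maximiser of `Z_β` with the most `π`-plaquettes has flux `π` everywhere** (`t ≥ 0`,
`β ≥ 0`, `L` even `≥ 4`). [cite: Lieb1994, Theorem and p. 2 ("repeated reflection")] -/
theorem plaq_eq_neg_one_of_max (hL : Even L) (h4 : 4 ≤ L) {β t : ℝ} (hβ : 0 ≤ β) (ht : 0 ≤ t) (U : ℝ)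
    {u₀ : Cfg L} (hu₀ : u₀ ∈ cfgSet L) (hmax : IsMaxOn (Zre β t U) (cfgSet L) u₀)
    (hcount : ∀ u ∈ cfgSet L, IsMaxOn (Zre β t U) (cfgSet L) u → piCount u ≤ piCount u₀)
    (σ : Fin 2) (x : FermionTorus 2 L) : plaq u₀ σ x = -1 := by
  by_contra hbad
  have h2 : 2 ≤ L := by omega
  -- translate the bad plaquette onto the cut
  obtain ⟨d, hd⟩ := exists_transl_isCut h2 x
  set u₁ := translate d u₀ with hu₁def
  have hu₁ : IsCfg u₁ := isCfg_translate d hu₀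
  have hZ₁ : Zre β t U u₁ = Zre β t U u₀ := Zre_translate d u₀ β t U
  have hbad₁ : plaq u₁ σ (transl d x) ≠ -1 := by rwa [hu₁def, plaq_translate]
  -- gauge the cut bonds
  set u₂ := gaugeFix u₁ with hu₂def
  have hu₂ : IsCfg u₂ := isCfg_gaugeFix hu₁
  have hZ₂ : Zre β t U u₂ = Zre β t U u₀ := by rw [hu₂def, Zre_gaugeFix hu₁, hZ₁]
  have hbad₂ : plaq u₂ σ (transl d x) ≠ -1 := by rwa [hu₂def, plaq_gaugeFix hu₁]
  have hcount₂ : piCount u₂ = piCount u₀ := by rw [hu₂def, piCount_gaugeFix hu₁, hu₁def, piCount_translate]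
  have hcut₂ : ∀ σ x, IsBoundary L x → u₂ σ x (reflect x) = 1 := gaugeFix_cut hL h4 hu₁
  -- reflect
  have hmax₂ : IsMaxOn (Zre β t U) (cfgSet L) u₂ := fun v hv => by
    rw [Set.mem_setOf_eq, hZ₂]; exact hmax hv
  have hLLmem : amplLL u₂ ∈ cfgSet L := isCfg_amplLL hu₂
  have hRRmem : amplRR u₂ ∈ cfgSet L := isCfg_amplRR hu₂
  have hineq := Zre_sq_le hL h4 hβ ht U hu₂ hcut₂
  have hZpos := Zre_pos hu₂ β t U
  have hLL_le : Zre β t U (amplLL u₂) ≤ Zre β t U u₂ := hmax₂ hLLmem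
  have hRR_le : Zre β t U (amplRR u₂) ≤ Zre β t U u₂ := hmax₂ hRRmem
  have hLLpos := Zre_pos (isCfg_amplLL hu₂) β t U
  have hRRpos := Zre_pos (isCfg_amplRR hu₂) β t U
  -- both reflected configurations are maximisers
  have hLL_eq : Zre β t U (amplLL u₂) = Zre β t U u₂ := by
    by_contra hne
    have hlt : Zre β t U (amplLL u₂) < Zre β t U u₂ := lt_of_le_of_ne hLL_le hne
    nlinarith [mul_lt_mul hlt hRR_le hRRpos hZpos.le]
  have hRR_eq : Zre β t U (amplRR u₂) = Zre β t U u₂ := by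
    by_contra hne
    have hlt : Zre β t U (amplRR u₂) < Zre β t U u₂ := lt_of_le_of_ne hRR_le hne
    nlinarith [mul_lt_mul' hLL_le hlt hRRpos.le hZpos]
  have hmaxLL : IsMaxOn (Zre β t U) (cfgSet L) (amplLL u₂) := fun v hv => by
    rw [Set.mem_setOf_eq, hLL_eq]; exact hmax₂ hv
  have hmaxRR : IsMaxOn (Zre β t U) (cfgSet L) (amplRR u₂) := fun v hv => by
    rw [Set.mem_setOf_eq, hRR_eq]; exact hmax₂ hv
  -- count
  have hc := piCount_symm_add hL h4 (fun σ x y => (hu₂ σ x y).1) (fun σ x y => (hu₂ σ x y).2) hcut₂ hd hbad₂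
  have h1 := hcount _ hLLmem hmaxLL
  have h2' := hcount _ hRRmem hmaxRR
  omega

/-- **Existence of an optimal `π`-flux configuration**: for `β ≥ 0`, `t ≥ 0`, `L` even `≥ 4`,
some phase configuration with flux `π` through every plaquette (both spins) maximises `Z_β` over
all phase configurations. [cite: Lieb1994, Theorem ("Flux π is optimal")] -/
theorem exists_isMaxOn_piFlux (hL : Even L) (h4 : 4 ≤ L) {β t : ℝ} (hβ : 0 ≤ β) (ht : 0 ≤ t) (U : ℝ) :
    ∃ u₀ ∈ cfgSet L, IsMaxOn (Zre β t U) (cfgSet L) u₀ ∧ ∀ σ x, plaq u₀ σ x = -1 := by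
  -- maximisers exist
  obtain ⟨v, hv, hvmax⟩ := (isCompact_cfgSet (L := L)).exists_isMaxOn ⟨_, one_mem_cfgSet⟩
    (continuous_Zre β t U).continuousOn
  -- among the maximisers, one with the most `π`-plaquettes
  set S : Set ℕ := {n | ∃ u ∈ cfgSet L, IsMaxOn (Zre β t U) (cfgSet L) u ∧ piCount u = n} with hS
  have hSne : S.Nonempty := ⟨piCount v, v, hv, hvmax, rfl⟩
  have hSbdd : BddAbove S := ⟨Fintype.card (Fin 2 × FermionTorus 2 L), by
    rintro n ⟨u, -, -, rfl⟩
    exact Finset.card_le_univ _⟩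
  obtain ⟨u₀, hu₀, hmax, hcnt⟩ := Nat.sSup_mem hSne hSbdd
  refine ⟨u₀, hu₀, hmax, plaq_eq_neg_one_of_max hL h4 hβ ht U hu₀ hmax (fun u hu humax => ?_)⟩
  rw [hcnt]
  exact le_csSup hSbdd ⟨u, hu, humax, rfl⟩

/-! ### From phases to configurations and back -/

/-- The configuration of a phase function: `u = e^{iθ}`. [cite: Lieb1994, p. 1] -/
def cfgOfPhase (θ : Fin 2 → FermionTorus 2 L → FermionTorus 2 L → ℝ) : Cfg L :=
  fun σ x y => Complex.exp (Complex.I * (θ σ x y : ℂ))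

omit [NeZero L] in
/-- `phaseHopping t θ = t · e^{iθ}`. [folklore] -/
theorem phaseHopping_eq_Tamp (t : ℝ) (θ : Fin 2 → FermionTorus 2 L → FermionTorus 2 L → ℝ) :
    phaseHopping t θ = Tamp t (cfgOfPhase θ) := rfl

omit [NeZero L] in
/-- An antisymmetric phase function gives a configuration. [folklore] -/
theorem isCfg_cfgOfPhase {θ : Fin 2 → FermionTorus 2 L → FermionTorus 2 L → ℝ}
    (hθ : ∀ σ x y, θ σ y x = -θ σ x y) : IsCfg (cfgOfPhase θ) := by
  intro σ x y
  constructor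
  · show ‖Complex.exp (Complex.I * (θ σ x y : ℂ))‖ = 1
    rw [mul_comm, Complex.norm_exp_ofReal_mul_I]
  · show Complex.exp (Complex.I * (θ σ y x : ℂ)) = star (Complex.exp (Complex.I * (θ σ x y : ℂ)))
    rw [hθ, Complex.star_def, ← Complex.exp_conj, map_mul, Complex.conj_I, Complex.conj_ofReal,
      Complex.ofReal_neg]
    congr 1
    ring

/-- **The phase function of a configuration**: `θ(x,y) = arg u(x,y)` for `x < y`, extended
antisymmetrically (and `0` on the diagonal). [folklore] -/
def liftPhase (u : Cfg L) : Fin 2 → FermionTorus 2 L → FermionTorus 2 L → ℝ :=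
  fun σ x y => if x < y then Complex.arg (u σ x y) else if y < x then -Complex.arg (u σ y x) else 0

omit [NeZero L] in
/-- The lifted phases are antisymmetric. [folklore] -/
theorem liftPhase_antisymm (u : Cfg L) (σ : Fin 2) (x y : FermionTorus 2 L) :
    liftPhase u σ y x = -liftPhase u σ x y := by
  unfold liftPhase
  rcases lt_trichotomy x y with h | rfl | h
  · rw [if_neg (not_lt.2 h.le), if_pos h, if_pos h]
  · simp
  · rw [if_pos h, if_neg (not_lt.2 h.le), if_pos h, neg_neg]

omit [NeZero L] in
/-- Off the diagonal the lift reproduces the configuration: `e^{iθ(x,y)} = u(x,y)` for `x ≠ y`.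
[folklore] -/
theorem cfgOfPhase_liftPhase {u : Cfg L} (hu : IsCfg u) (σ : Fin 2) {x y : FermionTorus 2 L} (hxy : x ≠ y) :
    cfgOfPhase (liftPhase u) σ x y = u σ x y := by
  have key : ∀ a b : FermionTorus 2 L, Complex.exp (Complex.I * (Complex.arg (u σ a b) : ℂ)) = u σ a b := by
    intro a b
    have h := Complex.norm_mul_exp_arg_mul_I (u σ a b)
    rw [(hu σ a b).1, Complex.ofReal_one, one_mul, mul_comm] at h
    exact h
  show Complex.exp (Complex.I * (liftPhase u σ x y : ℂ)) = u σ x y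
  unfold liftPhase
  rcases lt_or_gt_of_ne hxy with h | h
  · rw [if_pos h, key]
  · rw [if_neg (not_lt.2 h.le), if_pos h, Complex.ofReal_neg, (hu σ y x).2]
    conv_rhs => rw [← key y x]
    rw [Complex.star_def, ← Complex.exp_conj, map_mul, Complex.conj_I, Complex.conj_ofReal]
    congr 1
    ring

omit [NeZero L] in
/-- The Hamiltonian of the lift is the Hamiltonian of the configuration (the diagonal is never a
bond). [folklore] -/
theorem Ham_cfgOfPhase_liftPhase {u : Cfg L} (hu : IsCfg u) (t U : ℝ) :
    Ham t U (cfgOfPhase (liftPhase u)) = Ham t U u := by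
  refine peierlsHubbard_congr _ (fun σ x y hxy => ?_) U
  simp only [Tamp, cfgOfPhase_liftPhase hu σ hxy.ne]

/-- `torusStep i x = x + eᵢ`. [folklore] -/
theorem torusStep_eq_shift (i : Fin 2) (x : FermionTorus 2 L) : torusStep i x = shift x i := by
  rw [torusStep, ← toTorusSite_shift, FermionTorus.ofTorusSite_toTorusSite]

/-- **Flux `π` of the lift**: if every plaquette product of `u` is `-1`, the lifted phases have
flux `π (mod 2π)` through every plaquette. [cite: Lieb1994, p. 1 (flux = `Σφ` mod `2π`)] -/
theorem hasPiFlux_liftPhase (h2 : 2 ≤ L) {u : Cfg L} (hu : IsCfg u) (hpi : ∀ σ x, plaq u σ x = -1) :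
    HasPiFlux (liftPhase u) := by
  intro σ x
  set θ := liftPhase u with hθ
  have hne1 : x ≠ shift x 0 := (adj_shift h2 x 0).ne
  have hne2 : shift x 0 ≠ shift (shift x 0) 1 := (adj_shift h2 _ 1).ne
  have hne3 : shift (shift x 0) 1 ≠ shift x 1 := by
    rw [shift_comm]; exact (adj_shift h2 _ 0).ne.symm
  have hne4 : shift x 1 ≠ x := (adj_shift h2 x 1).ne.symm
  have hexp : Complex.exp (Complex.I * (plaquetteFlux θ σ x : ℂ)) = -1 := by
    rw [plaquetteFlux, torusStep_eq_shift, torusStep_eq_shift, torusStep_eq_shift]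
    push_cast
    rw [mul_add, mul_add, mul_add, Complex.exp_add, Complex.exp_add, Complex.exp_add]
    have e1 := cfgOfPhase_liftPhase hu σ hne1
    have e2 := cfgOfPhase_liftPhase hu σ hne2
    have e3 := cfgOfPhase_liftPhase hu σ hne3
    have e4 := cfgOfPhase_liftPhase hu σ hne4
    simp only [cfgOfPhase] at e1 e2 e3 e4
    rw [← hθ] at e1 e2 e3 e4
    rw [e1, e2, e3, e4, ← hpi σ x, plaq]
  -- `exp(i(F - π)) = 1`
  have h1 : Complex.exp (Complex.I * ((plaquetteFlux θ σ x - Real.pi : ℝ) : ℂ)) = 1 := by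
    push_cast
    rw [mul_sub, Complex.exp_sub, hexp, mul_comm Complex.I, Complex.exp_pi_mul_I]
    norm_num
  obtain ⟨n, hn⟩ := Complex.exp_eq_one_iff.1 h1
  refine ⟨n, ?_⟩
  have h3 : ((plaquetteFlux θ σ x - Real.pi : ℝ) : ℂ) = (n * (2 * Real.pi) : ℝ) := by
    have hI : Complex.I ≠ 0 := Complex.I_ne_zero
    have := hn
    rw [show (n : ℂ) * (2 * Real.pi * Complex.I) = Complex.I * ((n * (2 * Real.pi) : ℝ) : ℂ) by push_cast; ring] at this
    exact mul_left_cancel₀ hI this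
  have h4 := Complex.ofReal_injective h3
  linarith

/-! ### The theorem -/

/-- **Part (1), `0 ≤ β < ∞`**: for every admissible `θ` some admissible `π`-flux `θ'` has
`Z_β(θ) ≤ Z_β(θ')`. [cite: Lieb1994, Theorem] -/
theorem fluxPi_partitionFn (hL : Even L) (h4 : 4 ≤ L) {t : ℝ} (ht : 0 ≤ t) (U : ℝ) {β : ℝ} (hβ : 0 ≤ β)
    (θ : Fin 2 → FermionTorus 2 L → FermionTorus 2 L → ℝ) (hθ : ∀ σ x y, θ σ y x = -θ σ x y) :
    ∃ θ' : Fin 2 → FermionTorus 2 L → FermionTorus 2 L → ℝ, (∀ σ x y, θ' σ y x = -θ' σ x y) ∧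
      HasPiFlux θ' ∧
      ((peierlsHubbardTorus L t U θ).partitionFn β).re ≤ ((peierlsHubbardTorus L t U θ').partitionFn β).re := by
  obtain ⟨u₀, hu₀, hmax, hpi⟩ := exists_isMaxOn_piFlux hL h4 hβ ht U
  refine ⟨liftPhase u₀, liftPhase_antisymm u₀, hasPiFlux_liftPhase (by omega) hu₀ hpi, ?_⟩
  have h1 : ((peierlsHubbardTorus L t U θ).partitionFn β).re = Zre β t U (cfgOfPhase θ) := rfl
  have h2 : ((peierlsHubbardTorus L t U (liftPhase u₀)).partitionFn β).re = Zre β t U u₀ := by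
    show Zre β t U (cfgOfPhase (liftPhase u₀)) = _
    rw [Zre, Ham_cfgOfPhase_liftPhase hu₀]
    rfl
  rw [h1, h2]
  exact hmax (isCfg_cfgOfPhase hθ)

/-- The `π`-flux class is compact. [folklore] -/
theorem isCompact_piFluxSet : IsCompact {u ∈ cfgSet L | ∀ σ x, plaq u σ x = -1} := by
  have h : {u ∈ cfgSet L | ∀ σ x, plaq u σ x = -1} = cfgSet L ∩ ⋂ σ : Fin 2, ⋂ x : FermionTorus 2 L,
      {u : Cfg L | plaq u σ x = -1} :=
    Set.ext fun u => ⟨fun hu => ⟨hu.1, Set.mem_iInter.2 fun σ => Set.mem_iInter.2 fun x => hu.2 σ x⟩,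
      fun hu => ⟨hu.1, fun σ x => Set.mem_iInter.1 (Set.mem_iInter.1 hu.2 σ) x⟩⟩
  rw [h]
  refine isCompact_cfgSet.inter_right (isClosed_iInter fun σ => isClosed_iInter fun x => isClosed_eq ?_ continuous_const)
  simp only [plaq]
  fun_prop

/-- **Part (2), `β = ∞`**: for every admissible `θ` some admissible `π`-flux `θ'` has
`E₀(θ') ≤ E₀(θ)` (ground-state energy over all of Fock space). [cite: Lieb1994, Theorem and Remark (iii)] -/
theorem fluxPi_groundEnergy (hL : Even L) (h4 : 4 ≤ L) {t : ℝ} (ht : 0 ≤ t) (U : ℝ)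
    (θ : Fin 2 → FermionTorus 2 L → FermionTorus 2 L → ℝ) (hθ : ∀ σ x y, θ σ y x = -θ σ x y) :
    ∃ θ' : Fin 2 → FermionTorus 2 L → FermionTorus 2 L → ℝ, (∀ σ x y, θ' σ y x = -θ' σ x y) ∧
      HasPiFlux θ' ∧
      (peierlsHubbardTorus L t U θ').groundEnergy ≤ (peierlsHubbardTorus L t U θ).groundEnergy := by
  set K := {u ∈ cfgSet L | ∀ σ x, plaq u σ x = -1} with hK
  -- the `π`-flux class is nonempty (optimal configuration at `β = 0`)
  obtain ⟨w, hw, -, hwpi⟩ := exists_isMaxOn_piFlux hL h4 (le_refl (0 : ℝ)) ht U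
  have hKne : K.Nonempty := ⟨w, hw, hwpi⟩
  -- minimise the ground energy on it
  obtain ⟨u₁, ⟨hu₁, hpi₁⟩, hmin⟩ := isCompact_piFluxSet.exists_isMinOn hKne
    ((continuousOn_groundEnergy t U).mono fun u hu => hu.1)
  refine ⟨liftPhase u₁, liftPhase_antisymm u₁, hasPiFlux_liftPhase (by omega) hu₁ hpi₁, ?_⟩
  have hE : (peierlsHubbardTorus L t U (liftPhase u₁)).groundEnergy = (Ham t U u₁).groundEnergy := by
    show (Ham t U (cfgOfPhase (liftPhase u₁))).groundEnergy = _
    rw [Ham_cfgOfPhase_liftPhase hu₁]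
  rw [hE]
  show (Ham t U u₁).groundEnergy ≤ (Ham t U (cfgOfPhase θ)).groundEnergy
  set v := cfgOfPhase θ with hv
  have hvc : IsCfg v := isCfg_cfgOfPhase hθ
  -- `E₀(u₁) ≤ E₀(v) + (log D)/n` for every `n ≥ 1`
  set D : ℝ := (Fintype.card (Finset (Orb (FermionTorus 2 L))) : ℝ) with hD
  have hstep : ∀ n : ℕ, 0 < n → (Ham t U u₁).groundEnergy ≤ (Ham t U v).groundEnergy + Real.log D / n := by
    intro n hn
    obtain ⟨uₙ, huₙ, hmaxₙ, hpiₙ⟩ := exists_isMaxOn_piFlux hL h4 (Nat.cast_nonneg n) ht U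
    have hZ : Zre n t U v ≤ Zre n t U uₙ := hmaxₙ hvc
    have hE := groundEnergy_le_of_partitionFn_le (Ham_isHermitian hvc t U) (Ham_isHermitian huₙ t U)
      (Nat.cast_pos.2 hn) hZ
    exact (hmin ⟨huₙ, hpiₙ⟩).trans hE
  -- let `n → ∞`
  by_contra hlt
  push Not at hlt
  set δ := (Ham t U u₁).groundEnergy - (Ham t U v).groundEnergy with hδ
  have hδpos : 0 < δ := by rw [hδ]; linarith
  obtain ⟨n, hn⟩ := exists_nat_gt (Real.log D / δ)
  have hnpos : 0 < n := by
    rcases Nat.eq_zero_or_pos n with rfl | h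
    · have hlog : 0 ≤ Real.log D := Real.log_nonneg (by rw [hD]; exact_mod_cast Fintype.card_pos)
      have : (0 : ℝ) ≤ Real.log D / δ := div_nonneg hlog hδpos.le
      simp at hn; linarith
    · exact h
  have h1 := hstep n hnpos
  have h2 : Real.log D / n < δ := by
    rw [div_lt_iff₀ (Nat.cast_pos.2 hnpos)]
    rw [div_lt_iff₀ hδpos] at hn
    linarith
  linarith

end LiebRP

/-- **Discharge of `Lieb1994_fluxPi_torus`** — Lieb's flux-phase theorem on the even square torus
[Lieb1994, Theorem "Flux `π` is optimal", with p. 2 for the torus and Remark (iii) for `β = ∞`]: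
proved by the reflection-positivity inequality `partitionFn_sq_le_reflected` (Lieb's Lemma, eq.
(6), in the Kronecker/antilinear-DLS form), the extremal counting argument
(`exists_isMaxOn_piFlux`) and the `β → ∞` comparison of ground energies.
[cite: Lieb1994, Theorem (p. 4), Lemma eq. (6), p. 2, Remark (iii)] -/
theorem Lieb1994_fluxPi_torus_holds : Lieb1994_fluxPi_torus := by
  intro L _ hL h4 t U ht
  refine ⟨fun β hβ θ hθ => ?_, fun θ hθ => ?_⟩
  · obtain ⟨θ', h1, h2, h3⟩ := LiebRP.fluxPi_partitionFn hL h4 ht U hβ.le θ hθ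
    -- the statement of the fact and the proof files decide equality of torus sites through
    -- syntactically different (subsingleton) instances; `convert` bridges them
    exact ⟨θ', h1, h2, by convert h3 using 3⟩
  · obtain ⟨θ', h1, h2, h3⟩ := LiebRP.fluxPi_groundEnergy hL h4 ht U θ hθ
    exact ⟨θ', h1, h2, by convert h3 using 2⟩

end Literature.MathematicalPhysics.QuantumLattice

end
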